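import Mathlib
import Literature.Computability.Complexity.RangeAvoidance
import Literature.Computability.Complexity.SignDegreeXor
import HarnessLib.Audit
import Summits.PneNP.PneNP.Theorems.PstarSA2Blind
import Summits.PneNP.PneNP.Theorems.PairwiseSALevel
import Summits.PneNP.PneNP.Theorems.QuotientSAHeadline

/-!
# ROUND-22 COR-B: the `K_t`-block construction behind `SAAfterQuotientBlind` (cell `pnp-ideate`)

FRONTIER range-avoidance ladder, rung F-N3 context (restricted-model lower bounds for Sherali–Adams; nothing here bears on
`P` vs `NP`).

The instances of HEADLINE-22 (`QuotientSAHeadline.SAAfterQuotientBlind`).  A BLOCK SYSTEM `A : BlockSys s nb n'` assigns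
to each of `nb` blocks `β` and each ordered off-diagonal pair `(v, w)` of vertices of `K_{s+1}` (vertex set `Fin (s+1)`,
apex `0`) an A-variable `A.avar β v w ∈ Fin n'` ("the bit of the edge `{v,w}` on `v`'s side"), injectively inside each
block (`clean`).  From it:

* `pstar A : LocalMap 4 (nb·(s+1) + n') (nb·#E)` — the TYPED pure-`P⋆` instance: output `(β, {v<w})` reads
  `x_{β,v} ⊕ x_{β,w} ⊕ (a_{β,v,w} ∧ a_{β,w,v})`; XOR graph = `nb` disjoint copies of `K_{s+1}`;
* `quot A : LocalMap 6 n' (nb·#T)` — the EXACT XOR QUOTIENT: one pure-`IP₃` output per block and apex triangle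
  `{0, v⁺, w⁺}` (`v < w` in `Fin s`), reading the six A-slots of its three edges; `xorQuot` = the XOR-linear map
  `y ↦ (y_{0v⁺} ⊕ y_{0w⁺} ⊕ y_{v⁺w⁺})`; the apex triangles form a basis of the cycle space of `K_{s+1}`;
* `blk A b : LocalMap #S n' nb` — the BLOCK MAP: one output per block reading all `#S = (s+1)s` A-slots, predicate
  "the AND-vector satisfies every apex-triangle parity prescribed by `b`" (a coset of `Cut(K_{s+1})`), target all-true.

Proved here: purity/typing facts, `xorQuot` is XOR-linear and onto, the TRANSFER
`saFeasible_quot_of_blk : SAFeasibleAt 3 t (blk A b) 1 → SAFeasible t (quot A) b` (a triangle inside `S` has `6 ≥ 3` block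
slots inside `S`), and the ASSEMBLY
`saAfterQuotientBlind_of : PairwiseSALinearLevel → BlockLaws → BlockRange → BlockExpandExist → SAAfterQuotientBlind`
(hub at arity `K = #S`, ratio `(2K−5)/2 > K − 3`).  Targets left: `BlockLaws` (T22.1a(ii): the block law — biased product
conditioned on a coset of `Cut(K_t)` — is pairwise independent with marginals `1/√2`; kit j295726 confirms `t ≤ 6`),
`BlockRange` (the per-block cycle bridge `y ∈ Range(pstar A) ↔ xorQuot y ∈ Range(quot A)`), `BlockExpandExist` (T22.2-B:
clean block systems whose block map is `(n/c, (2K−5)/2)`-boundary expanding exist at every stretch; first moment).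
-/

set_option linter.dupNamespace false

open Finset
open Literature.Computability.Complexity
open Summit.PneNP.PneNP.Theorems.PstarSA2Blind (exists_not_mem_range)
open Summit.PneNP.PneNP.Theorems.PstarSALevel (SAFeasible varSet bdry)
open Summit.PneNP.PneNP.Theorems.PstarSASDPLevel (BoundaryExpandingQ)
open Summit.PneNP.PneNP.Theorems.PairwiseSALevel (PairwiseLaws SAFeasibleAt PairwiseSALinearLevel card_varSet_of_injective)
open Summit.PneNP.PneNP.Theorems.QuotientSAHeadline (IsXorLinear SAAfterQuotientBlind)

namespace Summit.PneNP.PneNP.Theorems.QuotientSABlocks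

/-! ### Index types of one block `K_{s+1}` (apex `0`, the other vertices are `Fin.succ v`, `v : Fin s`) -/

/-- Edges `{v, w}` of `K_{s+1}`, represented by the ordered pair with `v < w`. -/
abbrev Edge (s : ℕ) := {p : Fin (s + 1) × Fin (s + 1) // p.1 < p.2}

/-- Apex triangles `{0, v⁺, w⁺}` of `K_{s+1}`, indexed by pairs `v < w` in `Fin s`. -/
abbrev Tri (s : ℕ) := {p : Fin s × Fin s // p.1 < p.2}

/-- A-slots of a block: ordered off-diagonal pairs `(v, w)` ("the bit of the edge `{v,w}` on `v`'s side"). -/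
abbrev Slot (s : ℕ) := {p : Fin (s + 1) × Fin (s + 1) // p.1 ≠ p.2}

/-- Enumerations of the index types. -/
noncomputable def eEdge (s : ℕ) : Edge s ≃ Fin (Fintype.card (Edge s)) := Fintype.equivFin _
/-- Enumeration of the apex triangles. -/
noncomputable def eTri (s : ℕ) : Tri s ≃ Fin (Fintype.card (Tri s)) := Fintype.equivFin _
/-- Enumeration of the block slots. -/
noncomputable def eSlot (s : ℕ) : Slot s ≃ Fin (Fintype.card (Slot s)) := Fintype.equivFin _

/-- The arity of the block map: `K = #S = (s+1)s`. -/
abbrev kBlk (s : ℕ) : ℕ := Fintype.card (Slot s)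

/-- The three edges of the apex triangle `τ = {0, v⁺, w⁺}`. -/
def triEdge₁ {s : ℕ} (τ : Tri s) : Edge s := ⟨(0, τ.1.1.succ), Fin.succ_pos _⟩
/-- Second edge `{0, w⁺}`. -/
def triEdge₂ {s : ℕ} (τ : Tri s) : Edge s := ⟨(0, τ.1.2.succ), Fin.succ_pos _⟩
/-- Third edge `{v⁺, w⁺}`. -/
def triEdge₃ {s : ℕ} (τ : Tri s) : Edge s := ⟨(τ.1.1.succ, τ.1.2.succ), Fin.succ_lt_succ_iff.mpr τ.2⟩

/-- The two non-apex vertices of an apex triangle are distinct. -/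
theorem succ_ne_succ_of_tri {s : ℕ} (τ : Tri s) : τ.1.1.succ ≠ τ.1.2.succ :=
  fun h => (ne_of_lt τ.2) (Fin.succ_injective _ h)

/-- The six block slots read by the apex triangle `τ`: `(0,v⁺), (v⁺,0), (0,w⁺), (w⁺,0), (v⁺,w⁺), (w⁺,v⁺)`. -/
def triSlot {s : ℕ} (τ : Tri s) : Fin 6 → Slot s :=
  ![⟨(0, τ.1.1.succ), (Fin.succ_ne_zero _).symm⟩, ⟨(τ.1.1.succ, 0), Fin.succ_ne_zero _⟩,
    ⟨(0, τ.1.2.succ), (Fin.succ_ne_zero _).symm⟩, ⟨(τ.1.2.succ, 0), Fin.succ_ne_zero _⟩,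
    ⟨(τ.1.1.succ, τ.1.2.succ), succ_ne_succ_of_tri τ⟩, ⟨(τ.1.2.succ, τ.1.1.succ), (succ_ne_succ_of_tri τ).symm⟩]

/-- The six slots of an apex triangle are pairwise distinct. -/
theorem triSlot_injective {s : ℕ} (τ : Tri s) : Function.Injective (triSlot τ) := by
  have h1 : (τ.1.1.succ : Fin (s + 1)) ≠ 0 := Fin.succ_ne_zero _
  have h2 : (τ.1.2.succ : Fin (s + 1)) ≠ 0 := Fin.succ_ne_zero _
  have h3 : τ.1.1.succ ≠ τ.1.2.succ := succ_ne_succ_of_tri τ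
  simp [Function.Injective, Fin.forall_fin_succ, triSlot, h1, h2, h3, h1.symm, h2.symm, h3.symm]

/-- The value of the apex-triangle parity `AND_{0v⁺} ⊕ AND_{0w⁺} ⊕ AND_{v⁺w⁺}` on a slot assignment `a`. -/
def triVal {s : ℕ} (a : Slot s → Bool) (τ : Tri s) : Bool :=
  xor (xor (a (triSlot τ 0) && a (triSlot τ 1)) (a (triSlot τ 2) && a (triSlot τ 3))) (a (triSlot τ 4) && a (triSlot τ 5))

/-! ### Block systems and the three local maps -/

/-- A BLOCK SYSTEM: `nb` blocks `K_{s+1}`; `avar β v w` is the A-variable of the edge `{v,w}` of block `β` on `v`'s side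
(`v ≠ w`; diagonal values are junk), injective inside each block (`clean`). -/
structure BlockSys (s nb n' : ℕ) where
  /-- the A-variable of edge `{v,w}` of block `β` attached to `v` -/
  avar : Fin nb → Fin (s + 1) → Fin (s + 1) → Fin n'
  /-- inside a block the `(s+1)s` A-slots are pairwise distinct -/
  clean : ∀ β, Function.Injective fun p : Slot s => avar β p.1.1 p.1.2

variable {s nb n' : ℕ}

/-- Number of variables of the `P⋆` instance: `nb·(s+1)` XOR variables and `n'` AND variables. -/
abbrev nVars (s nb n' : ℕ) : ℕ := nb * (s + 1) + n'
/-- Number of outputs of the `P⋆` instance: one per block and edge. -/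
abbrev mOut (s nb : ℕ) : ℕ := nb * Fintype.card (Edge s)
/-- Number of outputs of the quotient: one per block and apex triangle. -/
abbrev βOut (s nb : ℕ) : ℕ := nb * Fintype.card (Tri s)

/-- The XOR variable `x_{β,v}`. -/
def xv (β : Fin nb) (v : Fin (s + 1)) : Fin (nVars s nb n') := Fin.castAdd n' (finProdFinEquiv (β, v))
/-- The AND variable `a`. -/
def av (a : Fin n') : Fin (nVars s nb n') := Fin.natAdd (nb * (s + 1)) a

/-- Output index of `(β, e)`. -/
noncomputable def outIdx (β : Fin nb) (e : Edge s) : Fin (mOut s nb) := finProdFinEquiv (β, eEdge s e)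
/-- Quotient output index of `(β, τ)`. -/
noncomputable def triIdx (β : Fin nb) (τ : Tri s) : Fin (βOut s nb) := finProdFinEquiv (β, eTri s τ)
/-- Decoding an output index. -/
noncomputable def outDec (j : Fin (mOut s nb)) : Fin nb × Edge s :=
  ((finProdFinEquiv.symm j).1, (eEdge s).symm (finProdFinEquiv.symm j).2)
/-- Decoding a quotient output index. -/
noncomputable def triDec (q : Fin (βOut s nb)) : Fin nb × Tri s :=
  ((finProdFinEquiv.symm q).1, (eTri s).symm (finProdFinEquiv.symm q).2)

/-- Decoding inverts encoding (quotient outputs). -/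
theorem triDec_triIdx (β : Fin nb) (τ : Tri s) : triDec (triIdx β τ) = (β, τ) := by
  simp [triDec, triIdx]

/-- Encoding inverts decoding (quotient outputs). -/
theorem triIdx_triDec (q : Fin (βOut s nb)) : triIdx (triDec q).1 (triDec q).2 = q := by
  simp only [triDec, triIdx, Equiv.apply_symm_apply, Prod.mk.eta]

/-- Decoding inverts encoding (`P⋆` outputs). -/
theorem outDec_outIdx (β : Fin nb) (e : Edge s) : outDec (outIdx β e) = (β, e) := by
  simp [outDec, outIdx]

/-- **The typed pure-`P⋆` instance** of a block system: output `(β, {v<w})` reads `x_{β,v}, x_{β,w}, a_{β,v,w}, a_{β,w,v}`. -/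
noncomputable def pstar (A : BlockSys s nb n') : LocalMap 4 (nVars s nb n') (mOut s nb) where
  vars j := ![xv (outDec j).1 (outDec j).2.1.1, xv (outDec j).1 (outDec j).2.1.2,
    av (A.avar (outDec j).1 (outDec j).2.1.1 (outDec j).2.1.2), av (A.avar (outDec j).1 (outDec j).2.1.2 (outDec j).2.1.1)]
  table _ := xorAndPred

/-- **The XOR quotient**: one pure-`IP₃` output per block and apex triangle, reading the six A-slots of its edges. -/
noncomputable def quot (A : BlockSys s nb n') : LocalMap 6 n' (βOut s nb) where
  vars q i := A.avar (triDec q).1 (triSlot (triDec q).2 i).1.1 (triSlot (triDec q).2 i).1.2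
  table _ := ipPred 3

/-- **The quotient map** `π`: `(π y)_{β,τ} = y_{β,0v⁺} ⊕ y_{β,0w⁺} ⊕ y_{β,v⁺w⁺}`. -/
noncomputable def xorQuot (s nb : ℕ) (y : Fin (mOut s nb) → Bool) : Fin (βOut s nb) → Bool := fun q =>
  xor (xor (y (outIdx (triDec q).1 (triEdge₁ (triDec q).2))) (y (outIdx (triDec q).1 (triEdge₂ (triDec q).2))))
    (y (outIdx (triDec q).1 (triEdge₃ (triDec q).2)))

/-- **The block map** for the quotient target `b`: output `β` reads all A-slots of block `β` and accepts iff every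
apex-triangle parity of the AND-vector equals the prescribed bit of `b`. -/
noncomputable def blk (A : BlockSys s nb n') (b : Fin (βOut s nb) → Bool) : LocalMap (kBlk s) n' nb where
  vars β k := A.avar β ((eSlot s).symm k).1.1 ((eSlot s).symm k).1.2
  table β u := decide (∀ τ : Tri s, triVal (fun p => u (eSlot s p)) τ = b (triIdx β τ))

/-! ### Purity, typing, linearity -/

/-- `IP₃` unfolded definitionally. -/
theorem ipPred_three_apply' (u : Fin 6 → Bool) :
    ipPred 3 u = xor (xor (xor false (u 0 && u 1)) (u 2 && u 3)) (u 4 && u 5) := rfl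

/-- `IP₃ u = (u₀ ∧ u₁) ⊕ (u₂ ∧ u₃) ⊕ (u₄ ∧ u₅)`. -/
theorem ipPred_three_apply (u : Fin 6 → Bool) :
    ipPred 3 u = xor (xor (u 0 && u 1) (u 2 && u 3)) (u 4 && u 5) := by
  rw [ipPred_three_apply', Bool.false_xor]

/-- A `4`-vector with pairwise distinct entries is injective. -/
theorem vec4_injective {α : Type*} {a b c d : α} (hab : a ≠ b) (hac : a ≠ c) (had : a ≠ d) (hbc : b ≠ c)
    (hbd : b ≠ d) (hcd : c ≠ d) : Function.Injective ![a, b, c, d] := by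
  simp [Function.Injective, Fin.forall_fin_succ, hab, hac, had, hbc, hbd, hcd, hab.symm, hac.symm, had.symm,
    hbc.symm, hbd.symm, hcd.symm]

/-- The quotient reads six distinct variables per output. -/
theorem quot_vars_injective (A : BlockSys s nb n') (q : Fin (βOut s nb)) : Function.Injective ((quot A).vars q) :=
  (A.clean (triDec q).1).comp (triSlot_injective (triDec q).2)

/-- The quotient is a pure `IP₃` instance. -/
theorem quot_isPure (A : BlockSys s nb n') : (quot A).IsPure (ipPred 3) :=
  ⟨fun _ => rfl, quot_vars_injective A⟩

/-- XOR variables and AND variables are distinct. -/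
theorem xv_ne_av (β : Fin nb) (v : Fin (s + 1)) (a : Fin n') : (xv β v : Fin (nVars s nb n')) ≠ av a := by
  intro h
  have h1 := (finProdFinEquiv (β, v)).2
  simp only [xv, av, Fin.ext_iff, Fin.val_castAdd, Fin.val_natAdd] at h
  omega

/-- The `P⋆` instance reads four distinct variables per output. -/
theorem pstar_vars_injective (A : BlockSys s nb n') (j : Fin (mOut s nb)) :
    Function.Injective ((pstar A).vars j) := by
  have hvw : (outDec j).2.1.1 ≠ (outDec j).2.1.2 := ne_of_lt (outDec j).2.2
  have hx : (xv (outDec j).1 (outDec j).2.1.1 : Fin (nVars s nb n')) ≠ xv (outDec j).1 (outDec j).2.1.2 := by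
    intro h
    have := finProdFinEquiv.injective (Fin.castAdd_injective _ _ h)
    exact hvw (Prod.mk.inj this).2
  have ha : A.avar (outDec j).1 (outDec j).2.1.1 (outDec j).2.1.2 ≠ A.avar (outDec j).1 (outDec j).2.1.2 (outDec j).2.1.1 := by
    intro h
    have := A.clean (outDec j).1 (a₁ := ⟨((outDec j).2.1.1, (outDec j).2.1.2), hvw⟩)
      (a₂ := ⟨((outDec j).2.1.2, (outDec j).2.1.1), hvw.symm⟩) h
    exact hvw (congrArg (fun p : Slot s => p.1.1) this)
  have ha' : (av (A.avar (outDec j).1 (outDec j).2.1.1 (outDec j).2.1.2) : Fin (nVars s nb n')) ≠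
      av (A.avar (outDec j).1 (outDec j).2.1.2 (outDec j).2.1.1) :=
    fun h => ha (Fin.natAdd_injective _ _ h)
  exact vec4_injective hx (xv_ne_av _ _ _) (xv_ne_av _ _ _) (xv_ne_av _ _ _) (xv_ne_av _ _ _) ha'

/-- The `P⋆` instance of a block system is pure (typed). -/
theorem pstar_isPure (A : BlockSys s nb n') : (pstar A).IsPure xorAndPred :=
  ⟨fun _ => rfl, pstar_vars_injective A⟩

/-- Rearranging a XOR of three XORs. -/
theorem xor3_xor3 (a b c a' b' c' : Bool) :
    xor (xor (xor a a') (xor b b')) (xor c c') = xor (xor (xor a b) c) (xor (xor a' b') c') := by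
  cases a <;> cases b <;> cases c <;> cases a' <;> cases b' <;> cases c' <;> rfl

/-- The quotient map `π` is XOR-linear. -/
theorem xorQuot_linear (s nb : ℕ) : IsXorLinear (xorQuot s nb) := by
  intro y y'
  funext q
  simp only [xorQuot]
  exact xor3_xor3 _ _ _ _ _ _

/-- The apex triangle of a non-apex edge `{v⁺, w⁺}`. -/
def edgeTri {s : ℕ} (e : Edge s) (h : e.1.1 ≠ 0) : Tri s :=
  ⟨(e.1.1.pred h, e.1.2.pred (lt_of_le_of_lt (Fin.zero_le _) e.2).ne'), by
    have h0 := Fin.lt_def.1 (Fin.pos_of_ne_zero h)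
    have h1 := Fin.lt_def.1 e.2
    simp only [Fin.val_zero] at h0
    rw [Fin.lt_def, Fin.val_pred, Fin.val_pred]
    omega⟩

/-- The apex triangle of the third edge of `τ` is `τ`. -/
@[simp] theorem edgeTri_triEdge₃ {s : ℕ} (τ : Tri s) (h) : edgeTri (triEdge₃ τ) h = τ := by
  apply Subtype.ext
  simp [edgeTri, triEdge₃]

/-- A section of `π`: put the prescribed bits on the edges `{v⁺, w⁺}` and `false` on the apex edges. -/
noncomputable def quotSection (s nb : ℕ) (b : Fin (βOut s nb) → Bool) : Fin (mOut s nb) → Bool := fun j =>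
  if h : (outDec j).2.1.1 = 0 then false else b (triIdx (outDec j).1 (edgeTri (outDec j).2 h))

/-- `quotSection` is a section of `π`. -/
theorem xorQuot_quotSection (s nb : ℕ) (b : Fin (βOut s nb) → Bool) : xorQuot s nb (quotSection s nb b) = b := by
  funext q
  have e1 : quotSection s nb b (outIdx (triDec q).1 (triEdge₁ (triDec q).2)) = false := by
    simp [quotSection, outDec_outIdx, triEdge₁]
  have e2 : quotSection s nb b (outIdx (triDec q).1 (triEdge₂ (triDec q).2)) = false := by
    simp [quotSection, outDec_outIdx, triEdge₂]
  have e3 : quotSection s nb b (outIdx (triDec q).1 (triEdge₃ (triDec q).2)) = b q := by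
    have hne : (triEdge₃ (triDec q).2).1.1 ≠ 0 := Fin.succ_ne_zero _
    simp only [quotSection, outDec_outIdx, hne, dite_false, edgeTri_triEdge₃, triIdx_triDec]
  simp only [xorQuot, e1, e2, e3, Bool.false_xor]

/-- The quotient map `π` is onto. -/
theorem xorQuot_surjective (s nb : ℕ) : Function.Surjective (xorQuot s nb) :=
  fun b => ⟨quotSection s nb b, xorQuot_quotSection s nb b⟩

/-! ### Evaluation of the quotient and of the block map; the transfer -/

/-- The quotient output `(β, τ)` evaluates to the apex-triangle parity of block `β`. -/
theorem quot_eval (A : BlockSys s nb n') (z : Fin n' → Bool) (q : Fin (βOut s nb)) :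
    (quot A).eval z q = triVal (fun p => z (A.avar (triDec q).1 p.1.1 p.1.2)) (triDec q).2 := by
  have : (quot A).eval z q = ipPred 3 (fun i => z ((quot A).vars q i)) := rfl
  rw [this, ipPred_three_apply]
  rfl

/-- Block `β` accepts iff every apex-triangle parity matches `b`. -/
theorem blk_eval (A : BlockSys s nb n') (b : Fin (βOut s nb) → Bool) (z : Fin n' → Bool) (β : Fin nb) :
    (blk A b).eval z β = true ↔ ∀ τ : Tri s, triVal (fun p => z (A.avar β p.1.1 p.1.2)) τ = b (triIdx β τ) := by
  show decide _ = true ↔ _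
  rw [decide_eq_true_iff]
  simp [blk]

/-- The variables of a quotient output are among the slots of its block. -/
theorem varSet_quot_subset (A : BlockSys s nb n') (b : Fin (βOut s nb) → Bool) (q : Fin (βOut s nb)) :
    varSet (quot A) q ⊆ varSet (blk A b) (triDec q).1 := by
  intro v hv
  simp only [varSet, Finset.mem_image, Finset.mem_univ, true_and] at hv ⊢
  obtain ⟨i, rfl⟩ := hv
  refine ⟨eSlot s (triSlot (triDec q).2 i), ?_⟩
  simp [blk, quot]

/-- **Transfer.**  Strong-form SA feasibility of the block map at the all-true target hands plain SA feasibility of the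
`IP₃` quotient at target `b`: an apex triangle with its `6 ≥ 3` variables inside `S` forces its block to be satisfied. -/
theorem saFeasible_quot_of_blk (A : BlockSys s nb n') (b : Fin (βOut s nb) → Bool) (t : ℕ)
    (h : SAFeasibleAt 3 t (blk A b) (fun _ => true)) : SAFeasible t (quot A) b := by
  obtain ⟨D, h1, h2, h3⟩ := h
  refine ⟨D, h1, h2, fun S q hS hsub x hx => ?_⟩
  have hcard : 3 ≤ (varSet (blk A b) (triDec q).1 ∩ S).card := by
    have h6 : (varSet (quot A) q).card = 6 := card_varSet_of_injective (quot A) (quot_vars_injective A q)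
    have hsub' : varSet (quot A) q ⊆ varSet (blk A b) (triDec q).1 ∩ S :=
      Finset.subset_inter (varSet_quot_subset A b q) hsub
    have := Finset.card_le_card hsub'
    omega
  have hall := (blk_eval A b x (triDec q).1).1 (h3 S (triDec q).1 hS hcard x hx)
  rw [quot_eval, hall (triDec q).2, triIdx_triDec]

/-! ### Targets -/

/-- **T22.1a(ii) (target): the block laws.**  For every block system and every quotient target `b`, the block map at the
all-true target carries pairwise-independent fibre laws with variable-consistent biases (all `1/√2`: the biased product
on the `(s+1)s` slots conditioned on the AND-vector lying in the coset of `Cut(K_{s+1})` cut out by the apex parities `b`;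
pairwise independent because `Cut(K_t)^⊥ = Cycle(K_t)` has minimum weight `3`; kit j295726). -/
@[conjecture] def BlockLaws : Prop :=
  ∀ (s nb n' : ℕ) (A : BlockSys s nb n') (b : Fin (βOut s nb) → Bool),
    ∃ (p : Fin n' → ℝ) (μ : Fin nb → (Fin (kBlk s) → Bool) → ℝ), PairwiseLaws (blk A b) (fun _ => true) p μ

/-- **Per-block cycle bridge (target).**  `π` is an exact quotient: `y ∈ Range(pstar A) ↔ π y ∈ Range(quot A)`
(`Range = Cut(G_L) ⊕ Clique(G_A)` for typed instances, `PstarTyped.mem_range_typed_iff`; `G_L = nb·K_{s+1}` and the apex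
triangles are a basis of the cycle space of `K_{s+1}`, whose orthogonal complement is the cut space). -/
@[conjecture] def BlockRange : Prop :=
  ∀ (s nb n' : ℕ) (A : BlockSys s nb n') (y : Fin (mOut s nb) → Bool), y ∈ (pstar A).range ↔ xorQuot s nb y ∈ (quot A).range

/-- **T22.2-B (target): expanding clean block systems exist at every stretch.**  For every `C` there are `s`, `c > 0` with
`K = (s+1)s ≥ 3` such that for every `N` some block system with `N ≤ n`, `n' ≤ n`, `n < m`, `C·n ≤ m`, `m ≤ β + n` has its
block map `(n / c, (2K−5)/2)`-boundary expanding (random A-slots, unclean blocks deleted, first moment: a non-expanding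
family of `f` blocks spans `< (K − 5/4)·f` A-variables). -/
@[conjecture] def BlockExpandExist : Prop :=
  ∀ C : ℕ, ∃ s c : ℕ, 0 < c ∧ 3 ≤ kBlk s ∧ ∀ N : ℕ, ∃ (nb n' : ℕ) (A : BlockSys s nb n'),
    N ≤ nVars s nb n' ∧ n' ≤ nVars s nb n' ∧ nVars s nb n' < mOut s nb ∧ C * nVars s nb n' ≤ mOut s nb ∧
    mOut s nb ≤ βOut s nb + nVars s nb n' ∧
    ∀ b : Fin (βOut s nb) → Bool, BoundaryExpandingQ (2 * kBlk s - 5) 2 (nVars s nb n' / c) (blk A b)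

/-! ### Assembly -/

/-- **HEADLINE-22 by name** from the hub `PairwiseSALinearLevel` (at arity `K = (s+1)s`, ratio `(2K−5)/2 > K − 3`), the
block laws, the per-block cycle bridge and the existence of expanding clean block systems. -/
theorem saAfterQuotientBlind_of (h0 : PairwiseSALinearLevel) (h1 : BlockLaws) (h3 : BlockRange)
    (h4 : BlockExpandExist) : SAAfterQuotientBlind := by
  intro C
  obtain ⟨s, c, hc, hK, hE⟩ := h4 C
  obtain ⟨c₀, hc₀, H⟩ := h0 (kBlk s) (2 * kBlk s - 5) 2 hK (by omega)
  refine ⟨c * c₀, Nat.mul_pos hc hc₀, fun N => ?_⟩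
  obtain ⟨nb, n', A, hN, hn', hnm, hCm, hβ, hB⟩ := hE N
  refine ⟨nVars s nb n', hN, mOut s nb, hCm, pstar A, pstar_isPure A, exists_not_mem_range _ hnm,
    n', βOut s nb, quot A, xorQuot s nb, hn', hβ, quot_isPure A, xorQuot_linear s nb, xorQuot_surjective s nb,
    h3 s nb n' A, fun b => ?_⟩
  obtain ⟨p, μ, hL⟩ := h1 s nb n' A b
  have hinj : ∀ β, Function.Injective ((blk A b).vars β) := fun β k k' h =>
    (eSlot s).symm.injective (A.clean β (a₁ := (eSlot s).symm k) (a₂ := (eSlot s).symm k') h)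
  have hfeas := H n' nb (nVars s nb n' / c) (blk A b) (fun _ => true) p μ hinj hL (hB b)
  have := saFeasible_quot_of_blk A b _ hfeas
  rwa [Nat.div_div_eq_div_mul] at this

end Summit.PneNP.PneNP.Theorems.QuotientSABlocks
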